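import Literature.AlgebraicGeometry.ShimuraVarieties.UnitaryBallQuotientDatum
import Literature.AlgebraicGeometry.HodgeTheory.RationalHodgeClasses
import Literature.NumberTheory.Transcendental.AnalytificationLocalBiholomorphism
import HarnessLib

/-!
# Local holomorphic sections of the uniformisation of a compact ball quotient (any rank, cone coordinates)

Topic `AlgebraicGeometry/ShimuraVarieties`, namespace `Literature.AlgebraicGeometry.ShimuraVarieties` (grouping
sub-namespace `UnitaryBallUniformisationDatum`). THEOREMS ONLY (no definition, no named fact, no instance, no `sorry`).

For `D : UnitaryBallUniformisationDatum p Y` (★ `UnitaryBallQuotientDatum.lean`: CM field `E ⊆ ℂ`, hermitian `H` of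
signature `(p,1)` at `τ₁`, `unif : ℂ^{p+1} → Y(ℂ)` continuous, open and onto on the negative cone of `H^{τ₁}`, with fibres
the `Γ·ℂˣ`-orbits, holomorphic in algebraic coordinates) and a Hodge model `A : HodgeModel p Y` (the complex manifold
`Y^an`), we prove — for EVERY rank `p`, without any ball/frame model:

* `mdifferentiableAt_symm_comp_unif` — the lift `ũ = ψ⁻¹ ∘ unif : negCone(H^{τ₁}) → Y^an` (`ψ = A.toComplexPoints`) is
  holomorphic at every cone vector (the tree's generic engine ★ `IsAnalytification.mdifferentiableAt_symm_comp`: holomorphy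
  into `Y^an` is tested on regular functions, [SerreGAGA1956] §2 n°6);
* `exists_mdifferentiableAt_section` — **if `unif` is injective modulo `ℂˣ` near a cone vector `v₀`** (the fibres through a
  neighbourhood of `v₀` meet it only along punctured lines; for torsion-free `Γ` this is the proper discontinuity of `Γ` on
  the projectivised cone, supplied by the consumer), **then `ũ` admits a HOLOMORPHIC LOCAL SECTION through `v₀`**: an open
  `W ∋ x₀ = ψ⁻¹(unif v₀)` of `Y^an` and `σ : Y^an → ℂ^{p+1}`, complex-differentiable at every point of `W`, with `σ x₀ = v₀`,
  `σ(W) ⊆ negCone` and `unif (σ y) = ψ y` on `W`.  Proof: restrict `ũ` to the affine hyperplane `v₀ + {e : e_{i₀} = 0}`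
  (`v₀ i₀ ≠ 0`), a `p`-dimensional slice transverse to the line `ℂ v₀`; there `ũ` is injective near `0` and holomorphic
  into the `p`-dimensional manifold `Y^an`, hence a local biholomorphism by Clements–Osgood (★
  `SCV.isOpen_image_of_injOn`, `SCV.differentiableOn_symm_of_differentiableOn`, [FritzscheGrauert2002] Ch. I §8); the section
  is `(slice) ∘ (local inverse) ∘ (chart)` — verbatim the argument of ★ `UnitaryBallLocalBiholomorphy.nonempty_chartInverse`
  (rank `2`, ball coordinates), here rank-free.

Consumers: morphisms OUT of a ball quotient are holomorphic as soon as they are holomorphic after composition with `unif`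
(★ `UnitaryBallSubBallMorphism`: sub-ball inclusions `Γ₁∖𝔻 → Γ∖𝔹²` and Hecke translations between disc quotients are
morphisms of the models — the GS programme's u1/u2 complex halves, cell `hodgecm-mathlib`).

## References
* [FritzscheGrauert2002] K. Fritzsche, H. Grauert, *From Holomorphic Functions to Complex Manifolds* (2002), Ch. I §8
  Thm. 8.5, Cor. 8.6; Ch. IV §1.
* [SerreGAGA1956] J.-P. Serre, *GAGA*, Ann. Inst. Fourier 6 (1956), §2 n°5–6.
* [BergeronMillsonMoeglin2016Balls] N. Bergeron, J. Millson, C. Moeglin, Acta Math. 216 (2016), Introduction §1.1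
  (`S(Γ) = Γ∖𝔹` is a complex manifold for torsion-free `Γ`), Part 2 §1.3.
-/

set_option autoImplicit false

noncomputable section

open Set Function Filter Matrix TopologicalSpace
open scoped Manifold ContDiff Topology

namespace Literature.AlgebraicGeometry.ShimuraVarieties

open Literature.AlgebraicGeometry.Motives (ComplexPoints AlgPoints SchemeOver)
open Literature.AlgebraicGeometry.HodgeTheory (HodgeModel)
open Literature.NumberTheory.Transcendental
open Literature.Analysis.Complex

namespace UnitaryBallUniformisationDatum

variable {p : ℕ} {Y : SchemeOver ℂ} (D : UnitaryBallUniformisationDatum p Y) (A : HodgeModel p Y)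

/-! ### §1. The slice `v₀ + {e : e i₀ = 0}` -/

/-- A negative vector is non-zero. [folklore] -/
private theorem ne_zero_of_mem_cone {v : Fin (p + 1) → ℂ} (hv : v ∈ D.cone) : v ≠ 0 := by
  rintro rfl
  rw [mem_negCone_iff] at hv
  simp at hv

/-- A negative vector has a non-zero coordinate. [folklore] -/
private theorem exists_apply_ne_zero_of_mem_cone {v : Fin (p + 1) → ℂ} (hv : v ∈ D.cone) : ∃ i, v i ≠ 0 :=
  Function.ne_iff.1 (D.ne_zero_of_mem_cone hv)

/-- The coordinate hyperplane `{e : e i₀ = 0}` of `ℂ^{p+1}` has dimension `p`. [folklore] -/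
private theorem finrank_ker_proj (i₀ : Fin (p + 1)) :
    Module.finrank ℂ ↥(LinearMap.ker (LinearMap.proj i₀ : (Fin (p + 1) → ℂ) →ₗ[ℂ] ℂ)) = p := by
  have h := LinearMap.finrank_range_add_finrank_ker (LinearMap.proj i₀ : (Fin (p + 1) → ℂ) →ₗ[ℂ] ℂ)
  rw [LinearMap.range_eq_top.2 (LinearMap.proj_surjective i₀), finrank_top, Module.finrank_self,
    Module.finrank_fin_fun] at h
  omega

/-- **The slice is transverse to the lines**: on `v₀ + {e : e i₀ = 0}` with `v₀ i₀ ≠ 0`, two points on the same complex line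
are equal. [folklore] -/
private theorem eq_of_add_eq_smul_add {i₀ : Fin (p + 1)} {v₀ : Fin (p + 1) → ℂ} (hv₀ : v₀ i₀ ≠ 0)
    {e e' : ↥(LinearMap.ker (LinearMap.proj i₀ : (Fin (p + 1) → ℂ) →ₗ[ℂ] ℂ))} {c : ℂ}
    (h : v₀ + (e : Fin (p + 1) → ℂ) = c • (v₀ + (e' : Fin (p + 1) → ℂ))) : e = e' := by
  have he : (e : Fin (p + 1) → ℂ) i₀ = 0 := e.2
  have he' : (e' : Fin (p + 1) → ℂ) i₀ = 0 := e'.2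
  have hi := congrFun h i₀
  simp only [Pi.add_apply, Pi.smul_apply, smul_eq_mul, he, he', add_zero] at hi
  have hc : c = 1 := by
    have : (c - 1) * v₀ i₀ = 0 := by rw [sub_mul, one_mul, ← hi, sub_self]
    rcases mul_eq_zero.1 this with h1 | h1
    · exact (sub_eq_zero.1 h1)
    · exact absurd h1 hv₀
  rw [hc, one_smul] at h
  exact Subtype.ext (add_left_cancel h)

/-! ### §2. The lift `ψ⁻¹ ∘ unif` is holomorphic on the cone -/

/-- **The uniformisation read in `Y^an` is holomorphic on the negative cone** (any rank `p`): `ψ⁻¹ ∘ unif` is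
complex-differentiable at every cone vector, `ψ = A.toComplexPoints` — from the datum's `continuousOn_unif` /
`differentiableOn_unif` by the generic engine ★ `IsAnalytification.mdifferentiableAt_symm_comp`.
[cite: SerreGAGA1956, §2 n°6 Prop. 3 Cor. 2] [cite: BergeronMillsonMoeglin2016Balls, Introduction §1.1] -/
theorem mdifferentiableAt_symm_comp_unif {v : Fin (p + 1) → ℂ} (hv : v ∈ D.cone) :
    MDifferentiableAt 𝓘(ℂ, Fin (p + 1) → ℂ) 𝓘(ℂ, A.model) (A.isAnalytification.homeomorph.symm ∘ D.unif) v := by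
  haveI := D.isSmoothProjective.smoothOfRelativeDimension
  exact A.isAnalytification.mdifferentiableAt_symm_comp (isOpen_negCone _) D.continuousOn_unif
    D.differentiableOn_unif hv

/-- The lift along an affine slice `e ↦ ψ⁻¹ (unif (v₀ + e))` (`e` in a linear subspace `S ≤ ℂ^{p+1}`) is holomorphic at
every `e` with `v₀ + e` in the cone. [cite: SerreGAGA1956, §2 n°6 Prop. 3 Cor. 2] -/
theorem mdifferentiableAt_symm_comp_unif_add (S : Submodule ℂ (Fin (p + 1) → ℂ)) (v₀ : Fin (p + 1) → ℂ)
    {e : ↥S} (he : v₀ + (e : Fin (p + 1) → ℂ) ∈ D.cone) :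
    MDifferentiableAt 𝓘(ℂ, ↥S) 𝓘(ℂ, A.model)
      (fun e' : ↥S => A.isAnalytification.homeomorph.symm (D.unif (v₀ + (e' : Fin (p + 1) → ℂ)))) e := by
  have hα : MDifferentiableAt 𝓘(ℂ, ↥S) 𝓘(ℂ, Fin (p + 1) → ℂ) (fun e' : ↥S => v₀ + (e' : Fin (p + 1) → ℂ)) e :=
    mdifferentiableAt_iff_differentiableAt.2 ((differentiableAt_const v₀).add S.subtypeL.differentiableAt)
  have h : MDifferentiableAt 𝓘(ℂ, ↥S) 𝓘(ℂ, A.model)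
      ((A.isAnalytification.homeomorph.symm ∘ D.unif) ∘ fun e' : ↥S => v₀ + (e' : Fin (p + 1) → ℂ)) e :=
    (D.mdifferentiableAt_symm_comp_unif A he).comp e hα
  exact h

/-! ### §3. Holomorphic local sections -/

/-- **Holomorphic local sections of the uniformisation** (any rank `p`).  Let `v₀` be a negative vector near which `unif` is
injective modulo `ℂˣ`: for some open `U ∋ v₀`, cone vectors `v, w ∈ U` with `unif v = unif w` are proportional.  Then there are
an open `W ∋ x₀ := ψ⁻¹(unif v₀)` of `Y^an` and `σ : Y^an → ℂ^{p+1}` with `σ x₀ = v₀`, `σ y ∈ negCone` and `unif (σ y) = ψ y` for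
`y ∈ W`, and `σ` complex-differentiable at every point of `W` — the uniformisation restricted to the slice
`v₀ + {e : e i₀ = 0}` is an injective holomorphic map between `p`-dimensional complex manifolds near `0`, hence a local
biholomorphism (Clements–Osgood, ★ `SCV.isOpen_image_of_injOn` / `SCV.differentiableOn_symm_of_differentiableOn`), and `σ` is
slice ∘ inverse ∘ chart. [cite: FritzscheGrauert2002, Ch. I §8 Thm. 8.5 and Cor. 8.6]
[cite: BergeronMillsonMoeglin2016Balls, Introduction §1.1] -/
theorem exists_mdifferentiableAt_section {v₀ : Fin (p + 1) → ℂ} (hv₀ : v₀ ∈ D.cone)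
    (hinj : ∃ U : Set (Fin (p + 1) → ℂ), IsOpen U ∧ v₀ ∈ U ∧
      ∀ v ∈ U, ∀ w ∈ U, v ∈ D.cone → w ∈ D.cone → D.unif v = D.unif w → ∃ c : ℂ, v = c • w) :
    ∃ (W : Set A.carrier) (σ : A.carrier → (Fin (p + 1) → ℂ)), IsOpen W ∧
      A.isAnalytification.homeomorph.symm (D.unif v₀) ∈ W ∧
      σ (A.isAnalytification.homeomorph.symm (D.unif v₀)) = v₀ ∧
      (∀ y ∈ W, σ y ∈ D.cone ∧ D.unif (σ y) = A.toComplexPoints y) ∧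
      ∀ y ∈ W, MDifferentiableAt 𝓘(ℂ, A.model) 𝓘(ℂ, Fin (p + 1) → ℂ) σ y := by
  classical
  obtain ⟨U, hUo, hv₀U, hU⟩ := hinj
  obtain ⟨i₀, hi₀⟩ := D.exists_apply_ne_zero_of_mem_cone hv₀
  -- the slice `S = {e : e i₀ = 0}` and the affine parametrisation `α e = v₀ + e`
  set S : Submodule ℂ (Fin (p + 1) → ℂ) := LinearMap.ker (LinearMap.proj i₀ : (Fin (p + 1) → ℂ) →ₗ[ℂ] ℂ) with hS
  set α : ↥S → (Fin (p + 1) → ℂ) := fun e => v₀ + (e : Fin (p + 1) → ℂ) with hα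
  have hαc : Continuous α := continuous_const.add continuous_subtype_val
  have hαd : Differentiable ℂ α := fun e => (differentiableAt_const v₀).add S.subtypeL.differentiableAt
  have hα0 : α 0 = v₀ := by simp [hα]
  -- the analytification, the base point, the chart
  set ψ := A.isAnalytification.homeomorph with hψ
  set u : (Fin (p + 1) → ℂ) → A.carrier := fun v => ψ.symm (D.unif v) with hu
  set x₀ : A.carrier := ψ.symm (D.unif v₀) with hx₀
  set φ := extChartAt 𝓘(ℂ, A.model) x₀ with hφ
  -- the open set `O ∋ 0` of the slice on which `Y = φ ∘ u ∘ α` is an injective holomorphic map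
  have hcont : ContinuousOn (u ∘ α) (α ⁻¹' (U ∩ D.cone)) := by
    refine (ψ.symm.continuous.comp_continuousOn (D.continuousOn_unif.comp hαc.continuousOn ?_))
    intro e he; exact he.2
  set O : Set ↥S := α ⁻¹' (U ∩ D.cone) ∩ (u ∘ α) ⁻¹' (chartAt A.model x₀).source with hO
  have hOo : IsOpen O :=
    hcont.isOpen_inter_preimage ((hUo.inter (isOpen_negCone _)).preimage hαc) (chartAt A.model x₀).open_source
  have h0O : (0 : ↥S) ∈ O := by
    refine ⟨?_, ?_⟩
    · show α 0 ∈ U ∩ D.cone; rw [hα0]; exact ⟨hv₀U, hv₀⟩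
    · show u (α 0) ∈ (chartAt A.model x₀).source; rw [hα0]; exact mem_chart_source _ x₀
  have hOcone : ∀ e ∈ O, α e ∈ D.cone := fun e he => he.1.2
  have hOU : ∀ e ∈ O, α e ∈ U := fun e he => he.1.1
  have hsrc : ∀ e ∈ O, u (α e) ∈ φ.source := fun e he => by
    rw [hφ, extChartAt_source]; exact he.2
  set Yf : ↥S → A.model := fun e => φ (u (α e)) with hYf
  have hud : ∀ e ∈ O, MDifferentiableAt 𝓘(ℂ, ↥S) 𝓘(ℂ, A.model) (u ∘ α) e := fun e he =>
    D.mdifferentiableAt_symm_comp_unif_add A S v₀ (hOcone e he)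
  have hYd : DifferentiableOn ℂ Yf O := fun e he => by
    have h2 : MDifferentiableAt 𝓘(ℂ, A.model) 𝓘(ℂ, A.model) (extChartAt 𝓘(ℂ, A.model) x₀) ((u ∘ α) e) :=
      mdifferentiableAt_extChartAt he.2
    exact (mdifferentiableAt_iff_differentiableAt.1 (h2.comp e (hud e he))).differentiableWithinAt
  have hYinj : InjOn Yf O := by
    intro e he e' he' h
    have h1 : u (α e) = u (α e') := φ.injOn (hsrc e he) (hsrc e' he') h
    have h2 : D.unif (α e) = D.unif (α e') := ψ.symm.injective h1
    obtain ⟨c, hc⟩ := hU (α e) (hOU e he) (α e') (hOU e' he') (hOcone e he) (hOcone e' he') h2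
    exact eq_of_add_eq_smul_add hi₀ hc
  have hdim : Module.finrank ℂ ↥S = Module.finrank ℂ A.model := by
    rw [hS, finrank_ker_proj, A.isAnalytification.finrank_eq]
  -- `Yf : O → Yf(O)` is an open partial homeomorphism with holomorphic inverse (Clements–Osgood)
  haveI : Nonempty ↥S := ⟨0⟩
  set e₀ : PartialEquiv ↥S A.model := hYinj.toPartialEquiv Yf O with he₀
  have hopen : IsOpenMap (O.restrict Yf) := by
    intro s hs
    obtain ⟨V, hV, rfl⟩ := isOpen_induced_iff.1 hs
    have himg : O.restrict Yf '' (Subtype.val ⁻¹' V) = Yf '' (O ∩ V) := by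
      ext y
      constructor
      · rintro ⟨⟨w, hwO⟩, hwV, rfl⟩
        exact ⟨w, ⟨hwO, hwV⟩, rfl⟩
      · rintro ⟨w, ⟨hwO, hwV⟩, rfl⟩
        exact ⟨⟨w, hwO⟩, hwV, rfl⟩
    rw [himg]
    exact SCV.isOpen_image_of_injOn hdim (hYd.mono inter_subset_left) (hOo.inter hV)
      (hYinj.mono inter_subset_left)
  set T : OpenPartialHomeomorph ↥S A.model :=
    OpenPartialHomeomorph.ofContinuousOpenRestrict e₀ hYd.continuousOn hopen hOo with hT
  have hTd : DifferentiableOn ℂ T T.source := hYd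
  have hWo : IsOpen (Yf '' O) := SCV.isOpen_image_of_injOn hdim hYd hOo hYinj
  have hgd : DifferentiableOn ℂ T.symm (Yf '' O) :=
    SCV.differentiableOn_symm_of_differentiableOn hdim T hTd
  -- the section `σ = α ∘ T⁻¹ ∘ φ` on `W = φ.source ∩ φ⁻¹' Yf(O)`
  set W : Set A.carrier := φ.source ∩ φ ⁻¹' (Yf '' O) with hW
  have hWopen : IsOpen W := by
    rw [hW, hφ]
    exact (continuousOn_extChartAt x₀).isOpen_inter_preimage (isOpen_extChartAt_source x₀) hWo
  have hx₀W : x₀ ∈ W := by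
    refine ⟨by rw [hφ]; exact mem_extChartAt_source x₀, ?_⟩
    show φ x₀ ∈ Yf '' O
    refine ⟨0, h0O, ?_⟩
    show φ (u (α 0)) = φ x₀
    rw [hα0]
  set σ : A.carrier → (Fin (p + 1) → ℂ) := fun y => α (T.symm (φ y)) with hσ
  have hTsymm_mem : ∀ y ∈ W, T.symm (φ y) ∈ O := fun y hy => T.map_target hy.2
  have hsec : ∀ y ∈ W, u (σ y) = y := by
    intro y hy
    have hright : Yf (T.symm (φ y)) = φ y := T.right_inv hy.2
    have h1 : φ (u (σ y)) = φ y := hright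
    exact φ.injOn (hsrc _ (hTsymm_mem y hy)) hy.1 h1
  refine ⟨W, σ, hWopen, hx₀W, ?_, fun y hy => ⟨hOcone _ (hTsymm_mem y hy), ?_⟩, fun y hy => ?_⟩
  · -- `σ x₀ = v₀`
    show α (T.symm (φ x₀)) = v₀
    have : φ x₀ = Yf 0 := by show φ x₀ = φ (u (α 0)); rw [hα0]
    rw [this]
    have h0 : T.symm (Yf 0) = 0 := T.left_inv h0O
    rw [h0, hα0]
  · -- `unif (σ y) = ψ y`
    have h := congrArg ψ (hsec y hy)
    simp only [hu, Homeomorph.apply_symm_apply] at h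
    rw [h, hψ, IsAnalytification.coe_homeomorph]
  · -- holomorphy of `σ` at `y ∈ W`
    have hφd : MDifferentiableAt 𝓘(ℂ, A.model) 𝓘(ℂ, A.model) φ y := by
      rw [hφ]; refine mdifferentiableAt_extChartAt ?_
      have := hy.1; rwa [hφ, extChartAt_source] at this
    have hTs : MDifferentiableAt 𝓘(ℂ, A.model) 𝓘(ℂ, ↥S) T.symm (φ y) :=
      mdifferentiableAt_iff_differentiableAt.2 (hgd.differentiableAt (hWo.mem_nhds hy.2))
    have hαm : MDifferentiableAt 𝓘(ℂ, ↥S) 𝓘(ℂ, Fin (p + 1) → ℂ) α (T.symm (φ y)) :=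
      mdifferentiableAt_iff_differentiableAt.2 (hαd _)
    have hTφ : MDifferentiableAt 𝓘(ℂ, A.model) 𝓘(ℂ, ↥S) (T.symm ∘ φ) y := hTs.comp y hφd
    have hcomp : MDifferentiableAt 𝓘(ℂ, A.model) 𝓘(ℂ, Fin (p + 1) → ℂ) (α ∘ (T.symm ∘ φ)) y := hαm.comp y hTφ
    exact hcomp

end UnitaryBallUniformisationDatum

end Literature.AlgebraicGeometry.ShimuraVarieties

end
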